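import Mathlib
import Literature.Analysis.FluidPDE.VectorCalculus
import Literature.Analysis.FluidPDE.LoadedSphereDynamics
import Summits.NavierStokesRegularity.NavierStokesRegularity.Theses.UnthreadedRigidityDoor
import Summits.NavierStokesRegularity.NavierStokesRegularity.Theorems.ThreadingFluxCentreJetDefs
import Summits.NavierStokesRegularity.NavierStokesRegularity.Theorems.RigidMotionDoorRigidFlow
import Summits.NavierStokesRegularity.NavierStokesRegularity.Theorems.ThreadingFluxSilentShellsTwoAxesTools
import HarnessLib

/-!
# Crux `PoloidalLiouville` (stmt-NavierStokesRegularity-1222, W1) / `UnthreadedRigidity` (stmt-…-27585, W2), crux idea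
# «platonic-germ-sieve» (ns-idea-15 g11): (σ7-rod) the one-parameter group of a skew generator of `ℝ³` IS the group of all
# rotations about its axis (Rodrigues)

Support file (Theorems-side; seat ns-wall-eng-8 g9, cell `ns-wall-extremal`, second file of item (σ7);
`--supports stmt-NavierStokesRegularity-1222 --as helper`; 0 kit).  Theorem-only.  Companion of
`Theorems/ThreadingFluxPlatonicInfinitesimalRotation.lean`, which reads W2's conclusion (`A` skew, `A ≠ 0`,
`D(u t)(x)[A (x − x₀)] = A (u t x)`) as equivariance under the one-parameter group `{exp (s • A)}` about `x₀`.  Here that group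
is identified, BY NAME with the Literature's Rodrigues rotation `Literature.Analysis.FluidPDE.rodrigues k θ`
(`LoadedSphereDynamics`: `R_{k,θ} a = cos θ • a + sin θ • (k × a) + (1 − cos θ)⟪k, a⟫ k`), with ALL rotations about the axis:

* `Platonic.exp_smul_crossCLM_apply` — **Rodrigues' formula as a one-parameter group**: for a unit vector `c`,
  `exp (θ • (c × ·)) x = rodrigues c θ x` for every angle `θ` (both sides solve `y′ = c × y`, `y 0 = x`; the difference `d` has
  `(‖d‖²)′ = 2⟪d, c × d⟫ = 0` — no ODE-uniqueness theorem is invoked);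
* `Platonic.exists_eq_crossCLM_of_inner_self_eq_zero` — **axial vector**: a skew operator of `ℝ³` (`⟪A x, x⟫ = 0` for all `x`,
  W2's binder) is `x ↦ w × x` (polarisation + the tree's `SilentShells.TwoAxes.exists_cross_of_skew` BY NAME, repackaged with
  `crossCLM`; coordinate forms: `SymmetryModuliCountSymmetricLiouville.skew_apply_eq`, whose file also has the operator-form
  Rodrigues velocity `hasDerivAt_rodrigues` for `B³ = −B`), `w ≠ 0` if `A ≠ 0`;
* `Platonic.exists_exp_smul_eq_rodrigues` — hence for skew `A ≠ 0` there are a unit `c` and `α ≠ 0` with `A = α • (c × ·)` and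
  `exp (s • A) = rodrigues c (s α)` for all `s`: the group `{exp (s • A)}` consists of the rotations about the axis `ℝ c` by
  ALL angles (`θ = s α`, `α ≠ 0`);
* `Platonic.map_rodrigues_centre_of_fderiv` — W2's EXACT conclusion shape for a differentiable slice `φ`,
  `Dφ(x)[A (x − x₀)] − A (φ x) = 0` for all `x` with `A` skew and non-zero, therefore says: `φ` is AXISYMMETRIC ABOUT THE LINE
  `x₀ + ℝ c` in the honest, integrated sense `φ (x₀ + R_{c,θ} (x − x₀)) = R_{c,θ} (φ x)` for every angle `θ`
  (`RigidMotionDoorRigidFlow.apply_flow_eq_of_fderiv` BY NAME + the identification);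
* `Platonic.rodrigues_equivariant_of_unthreadedRigidity` — HEADLINE, CONDITIONAL on `UnthreadedRigidity` (27585, OPEN) by name:
  W2 would make every window datum with differentiable slices axisymmetric, at all times of the window, about ONE fixed line
  `x₀ + ℝ c` — `u t (x₀ + R_{c,θ} (x − x₀)) = R_{c,θ} (u t x)` for every angle `θ` (what W2's docstring says in words).

HONEST LABEL: folklore linear algebra / calculus (Rodrigues 1840); information-grade glue strictly below W1/W2; TRUE as typed.
`UnthreadedRigidity` (27585), `PoloidalLiouville` (1222), `OctahedralCentreRigidity` and NS regularity are OPEN and NOT touched;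
W1/W2 movement 0.  [folklore]
-/

-- the summit and its single sub-problem share the name (CONVENTIONS §1)
set_option linter.dupNamespace false

noncomputable section

open Set Function Filter Metric
open scoped RealInnerProductSpace Topology
open NormedSpace (exp)
open Literature.Analysis.FluidPDE
open Summit.NavierStokesRegularity.NavierStokesRegularity.Theorems.PoloidalLiouville.CentreJet (E3)
open Summit.NavierStokesRegularity.NavierStokesRegularity.Theorems.RigidMotionDoorRigidFlow
  (inner_map_eq_neg apply_flow_eq_of_fderiv)
open Summit.NavierStokesRegularity.NavierStokesRegularity.Theorems.PoloidalLiouville.SilentShells (TwoAxes.exists_cross_of_skew)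

namespace Summit.NavierStokesRegularity.NavierStokesRegularity.Theorems.PoloidalLiouville.Platonic

/-! ### Cross-product identities (file-local, coordinates) -/

/-- `c × c = 0`. [folklore] -/
private theorem cross_self' (c : E3) : cross c c = 0 := by
  ext i
  fin_cases i <;> simp [cross]

/-- BAC−CAB: `c × (c × x) = ⟪c, x⟫ c − ‖c‖² x`. [folklore] -/
private theorem cross_cross_left' (c x : E3) : cross c (cross c x) = ⟪c, x⟫ • c - (‖c‖ ^ 2) • x := by
  have hn : ‖c‖ ^ 2 = ∑ i, c i * c i := by
    rw [EuclideanSpace.norm_eq, Real.sq_sqrt (Finset.sum_nonneg fun i _ => sq_nonneg _)]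
    exact Finset.sum_congr rfl fun i _ => by rw [Real.norm_eq_abs, sq_abs, sq]
  ext i
  fin_cases i <;>
    simp [cross, cross_apply, PiLp.inner_apply, hn, Fin.sum_univ_three, Matrix.cons_val_zero, Matrix.cons_val_one,
      Matrix.cons_val_two, Matrix.head_cons, Matrix.tail_cons] <;> ring

/-- `d ⟂ c × d`. [folklore] -/
private theorem inner_self_cross_right' (c d : E3) : ⟪d, cross c d⟫ = 0 := by
  simp [cross, cross_apply, PiLp.inner_apply, Fin.sum_univ_three, Matrix.cons_val_zero, Matrix.cons_val_one,
    Matrix.cons_val_two, Matrix.head_cons, Matrix.tail_cons]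
  ring

/-! ### Rodrigues' formula: `exp (θ • (c × ·)) = R_{c,θ}` for a unit axis `c` -/

/-- The Rodrigues curve `θ ↦ R_{c,θ} x` solves `y′ = c × y` (unit `c`). [folklore] -/
theorem hasDerivAt_rodrigues_cross {c : E3} (hc : ‖c‖ = 1) (x : E3) (σ : ℝ) :
    HasDerivAt (fun θ : ℝ => rodrigues c θ x) (crossCLM c (rodrigues c σ x)) σ := by
  have h := (((Real.hasDerivAt_cos σ).smul_const x).fun_add ((Real.hasDerivAt_sin σ).smul_const (cross c x))).fun_add
    ((((hasDerivAt_const σ (1 : ℝ)).fun_sub (Real.hasDerivAt_cos σ)).mul_const ⟪c, x⟫).smul_const c)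
  have hfun : (fun θ : ℝ => rodrigues c θ x) =
      fun θ => Real.cos θ • x + Real.sin θ • cross c x + ((1 - Real.cos θ) * ⟪c, x⟫) • c := by
    funext θ; rfl
  rw [hfun]
  refine h.congr_deriv ?_
  rw [rodrigues, map_add, map_add, map_smul, map_smul, map_smul, crossCLM_apply, crossCLM_apply, crossCLM_apply,
    cross_cross_left', cross_self', hc, one_pow]
  module

/-- **Rodrigues' formula as a one-parameter group.**  For a unit vector `c` and every angle `θ`,
`exp (θ • (c × ·)) x = R_{c,θ} x = cos θ • x + sin θ • (c × x) + (1 − cos θ)⟪c, x⟫ c`: the one-parameter group generated by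
the cross product with `c` is the group of rotations about the axis `ℝ c`, every angle attained.  Proof: `θ ↦ exp (θ • C) x` and
the Rodrigues curve both solve `y′ = c × y` with `y 0 = x`; their difference `d` has `(‖d‖²)′ = 2⟪d, c × d⟫ = 0`. [folklore] -/
theorem exp_smul_crossCLM_apply {c : E3} (hc : ‖c‖ = 1) (θ : ℝ) (x : E3) :
    exp (θ • crossCLM c) x = rodrigues c θ x := by
  have hE : ∀ σ : ℝ, HasDerivAt (fun σ : ℝ => exp (σ • crossCLM c) x) (crossCLM c (exp (σ • crossCLM c) x)) σ :=
    fun σ => by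
      simpa [mul_apply_eq_comp] using
        (hasDerivAt_exp_smul_const' (𝕂 := ℝ) (crossCLM c) σ).clm_apply (hasDerivAt_const σ x)
  have hd : ∀ σ : ℝ, HasDerivAt (fun σ : ℝ => ‖exp (σ • crossCLM c) x - rodrigues c σ x‖ ^ 2) 0 σ := fun σ => by
    refine (((hE σ).fun_sub (hasDerivAt_rodrigues_cross hc x σ)).norm_sq).congr_deriv ?_
    rw [← map_sub, crossCLM_apply, inner_self_cross_right', mul_zero]
  have hconst := is_const_of_deriv_eq_zero (fun σ => (hd σ).differentiableAt) (fun σ => (hd σ).deriv) θ 0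
  have h0 : ‖exp ((0 : ℝ) • crossCLM c) x - rodrigues c 0 x‖ ^ 2 = 0 := by
    rw [zero_smul ℝ (crossCLM c), NormedSpace.exp_zero, one_apply_eq_self, rodrigues_zero, sub_self, norm_zero,
      zero_pow two_ne_zero]
  rw [h0, sq_eq_zero_iff, norm_eq_zero, sub_eq_zero] at hconst
  exact hconst

/-! ### The axial vector of a skew operator of `ℝ³` -/

/-- **Axial vector.**  A skew operator of `ℝ³` (`⟪A x, x⟫ = 0` for all `x` — W2's binder) is the cross product with a vector,
`A = (w × ·)`: polarisation (`RigidMotionDoorRigidFlow.inner_map_eq_neg`) feeds the tree's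
`SilentShells.TwoAxes.exists_cross_of_skew` (skew-adjoint form) BY NAME; repackaged as an identity of continuous linear maps with
the Literature's `crossCLM`.  (Coordinate forms of the same fact: `SymmetryModuliCountSymmetricLiouville.skew_apply_eq` /
`skew_cube_eq_neg_smul`.) [folklore] -/
theorem exists_eq_crossCLM_of_inner_self_eq_zero {A : E3 →L[ℝ] E3} (hA : ∀ x, ⟪A x, x⟫ = 0) :
    ∃ w : E3, A = crossCLM w := by
  obtain ⟨w, hw⟩ := TwoAxes.exists_cross_of_skew A fun x y => by rw [inner_map_eq_neg hA x y, real_inner_comm]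
  exact ⟨w, ContinuousLinearMap.ext fun x => by rw [hw x, crossCLM_apply]⟩

/-- The axial vector of a NON-ZERO skew operator is non-zero. [folklore] -/
theorem axial_ne_zero_of_ne_zero {A : E3 →L[ℝ] E3} {w : E3} (hw : A = crossCLM w) (hA0 : A ≠ 0) : w ≠ 0 := by
  rintro rfl
  exact hA0 (by rw [hw, map_zero])

/-- **The one-parameter group of a non-zero skew operator of `ℝ³` is the full rotation group about its axis.**  For skew
`A ≠ 0` there are a unit vector `c` and `α ≠ 0` with `A = α • (c × ·)` and `exp (s • A) x = R_{c, sα} x` for all `s, x`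
(`rodrigues`, every angle `θ = s α` attained). [folklore] -/
theorem exists_exp_smul_eq_rodrigues {A : E3 →L[ℝ] E3} (hA : ∀ x, ⟪A x, x⟫ = 0) (hA0 : A ≠ 0) :
    ∃ c : E3, ‖c‖ = 1 ∧ ∃ α : ℝ, α ≠ 0 ∧ A = α • crossCLM c ∧
      ∀ (s : ℝ) (x : E3), exp (s • A) x = rodrigues c (s * α) x := by
  obtain ⟨w, hw⟩ := exists_eq_crossCLM_of_inner_self_eq_zero hA
  have hw0 : w ≠ 0 := axial_ne_zero_of_ne_zero hw hA0
  have hn : ‖w‖ ≠ 0 := norm_ne_zero_iff.2 hw0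
  have hc : ‖(‖w‖⁻¹ • w : E3)‖ = 1 := by
    rw [norm_smul, norm_inv, norm_norm, inv_mul_cancel₀ hn]
  have hAc : A = ‖w‖ • crossCLM (‖w‖⁻¹ • w) := by
    rw [hw, map_smul, smul_smul, mul_inv_cancel₀ hn, one_smul]
  refine ⟨‖w‖⁻¹ • w, hc, ‖w‖, hn, hAc, fun s x => ?_⟩
  rw [hAc, smul_smul]
  exact exp_smul_crossCLM_apply hc (s * ‖w‖) x

/-! ### W2's conclusion shape = axisymmetry about the line `x₀ + ℝ c`, every angle -/

/-- **W2's one axis, integrated, in the original coordinates.**  Let `A` be skew and non-zero and `φ` differentiable with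
`Dφ(x)[A (x − x₀)] − A (φ x) = 0` for all `x` (the conclusion of `UnthreadedRigidity` for one slice).  Then there are a unit
vector `c` and `α ≠ 0` with `A = α • (c × ·)`, and `φ` is AXISYMMETRIC ABOUT THE LINE `x₀ + ℝ c` in the honest sense: for EVERY
angle `θ`, `φ (x₀ + R_{c,θ} (x − x₀)) = R_{c,θ} (φ x)` (`RigidMotionDoorRigidFlow.apply_flow_eq_of_fderiv` BY NAME with
`c = −x₀`, `e₂ = 0`, at `s = θ / α`). [folklore] -/
theorem map_rodrigues_centre_of_fderiv {A : E3 →L[ℝ] E3} (hA : ∀ x, ⟪A x, x⟫ = 0) (hA0 : A ≠ 0) (x₀ : E3)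
    {φ : E3 → E3} (hφ : Differentiable ℝ φ) (h : ∀ x, fderiv ℝ φ x (A (x - x₀)) - A (φ x) = 0) :
    ∃ c : E3, ‖c‖ = 1 ∧ ∃ α : ℝ, α ≠ 0 ∧ A = α • crossCLM c ∧
      ∀ (θ : ℝ) (x : E3), φ (x₀ + rodrigues c θ (x - x₀)) = rodrigues c θ (φ x) := by
  obtain ⟨c, hc, α, hα, hAc, hexp⟩ := exists_exp_smul_eq_rodrigues hA hA0
  refine ⟨c, hc, α, hα, hAc, fun θ x => ?_⟩
  -- the flow of the Killing field `y ↦ A y + A (−x₀)` about `x₀`, by name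
  have hsym : ∀ y, fderiv ℝ φ y (A y + (A (-x₀) + 0)) = A (φ y) := fun y => by
    rw [add_zero, ← map_add, ← sub_eq_add_neg]
    exact sub_eq_zero.1 (h y)
  have key := apply_flow_eq_of_fderiv A (-x₀) (map_zero A) hφ hsym (θ / α) x
  rw [smul_zero, add_zero, map_neg, sub_neg_eq_add, hexp, hexp, hexp, div_mul_cancel₀ θ hα] at key
  -- key : φ (R x + (R (-x₀) + x₀)) = R (φ x); and R x + R (−x₀) + x₀ = x₀ + R (x − x₀) by linearity of R = exp (s • A)
  have hlin : rodrigues c θ (x - x₀) = rodrigues c θ x - rodrigues c θ x₀ := by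
    rw [← div_mul_cancel₀ θ hα, ← hexp, ← hexp, ← hexp, map_sub]
  rw [hlin, ← key]
  congr 1
  abel

/-- **HEADLINE — W2 read literally: the window solution is axisymmetric about ONE fixed line through `x₀`.**  ASSUMING
`UnthreadedRigidity` (stmt-27585, OPEN; taken by name as a hypothesis): for every window datum of W2 (`S` open preconnected;
`u` continuous, divergence free, Oseen-mild on `S`, bounded on sub-windows, unthreaded about `x₀`) whose slices are
differentiable, there is a unit vector `c` such that EVERY slice `u t`, `t ∈ S`, satisfies
`u t (x₀ + R_{c,θ} (x − x₀)) = R_{c,θ} (u t x)` for EVERY angle `θ` — axisymmetry about the line `x₀ + ℝ c` in the integrated sense,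
the same line for all times of the window.  Conditional glue (what W2 WOULD give); W2 OPEN; W1/W2 movement 0. [folklore] -/
theorem rodrigues_equivariant_of_unthreadedRigidity
    (hR : Summit.NavierStokesRegularity.NavierStokesRegularity.Theses.UnthreadedRigidityDoor.UnthreadedRigidity)
    (S : Set ℝ) (hS : IsOpen S) (hSc : IsPreconnected S) (u : ℝ → E3 → E3) (x₀ : E3)
    (hcont : ContinuousOn (Function.uncurry u) (S ×ˢ Set.univ))
    (hdiv : ∀ t ∈ S, VectorCalculus.IsDivFree (u t))
    (hmild : ∀ s ∈ S, ∀ t ∈ S, s < t → ∀ x, u t x =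
      Literature.Analysis.UnboundedOperators.heatExtension (u s) (t - s) x - oseenDuhamel 1 s u u t x)
    (hbdd : ∀ τ ∈ S, ∃ B : ℝ, ∀ t ∈ S, t ≤ τ → ∀ x, ‖u t x‖ ≤ B)
    (hunthr : ∀ t ∈ S, ∀ x, ⟪curl (u t) x, x - x₀⟫ = 0)
    (hdiff : ∀ t ∈ S, Differentiable ℝ (u t)) :
    ∃ c : E3, ‖c‖ = 1 ∧ ∀ t ∈ S, ∀ (θ : ℝ) (x : E3), u t (x₀ + rodrigues c θ (x - x₀)) = rodrigues c θ (u t x) := by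
  obtain ⟨A, hskew, hA0, hsym⟩ := hR S hS hSc u x₀ hcont hdiv hmild hbdd hunthr
  obtain ⟨c, hc, α, hα, hAc, hexp⟩ := exists_exp_smul_eq_rodrigues hskew hA0
  refine ⟨c, hc, fun t ht θ x => ?_⟩
  -- the same axis `c` serves every slice: repeat the flow argument of `map_rodrigues_centre_of_fderiv` with this `c`
  have hsym' : ∀ y, fderiv ℝ (u t) y (A y + (A (-x₀) + 0)) = A (u t y) := fun y => by
    rw [add_zero, ← map_add, ← sub_eq_add_neg]
    exact sub_eq_zero.1 (hsym t ht y)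
  have key := apply_flow_eq_of_fderiv A (-x₀) (map_zero A) (hdiff t ht) hsym' (θ / α) x
  rw [smul_zero, add_zero, map_neg, sub_neg_eq_add, hexp, hexp, hexp, div_mul_cancel₀ θ hα] at key
  have hlin : rodrigues c θ (x - x₀) = rodrigues c θ x - rodrigues c θ x₀ := by
    rw [← div_mul_cancel₀ θ hα, ← hexp, ← hexp, ← hexp, map_sub]
  rw [hlin, ← key]
  congr 1
  abel

end Summit.NavierStokesRegularity.NavierStokesRegularity.Theorems.PoloidalLiouville.Platonic

end
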